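import Summits.QuantumFields.YangMills.Theorems.RandomisedStokesOffSliverArith

/-!
# Route `RandomisedStokes` (LINE 18, crux stmt-QuantumFields-19936): glue `HistoryTailOfChaosL` (stmt-QuantumFields-23887) — engine, part 3:
# THE CHAOS TERM OFF THE SLIVER

Companion of `RandomisedStokesOffSliverArith` (same parameter `P = max u (j+1)`, same bounded-exponent lemma): the plaquette count
`9·8L^{3m}(L^h)³` times the chaos term `C_X β_K^{A_X} exp(−(c_X θ/(2D(j+1)γL^{−h}))^{α_X})` of the per-plaquette bound is `≤ A·2^{−h}`
off the sliver, because `θ/(2D(j+1)γL^{−h}) = p/(2D(j+1)g) ≥ P^{N−1}/(2D)` and `(N−1)α_X > 1`.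

Pure real analysis.  No crux, rung or summit is proved; the Yang–Mills mass gap is NOT proved by any of this.
Cell `ym-idea-1`, LEAD seat `ym-line-sfw-p2` g71 (free hands), `--supports stmt-QuantumFields-23887`.
References: T. Bałaban, CMP 102 (1985) 255–275 [Balaban1985UV3] ((3) p.256, (7) p.257).
-/

set_option autoImplicit false

noncomputable section

open MeasureTheory Filter Topology
open Literature.MathematicalPhysics.QuantumFieldTheory.Balaban1983to89
open Literature.MathematicalPhysics.QuantumFieldTheory.Balaban1983to89.T3ContinuumYM3Torus
open Literature.MathematicalPhysics.QuantumFieldTheory.Balaban1983to89.T3UnitScaleTilt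
open Literature.MathematicalPhysics.QuantumFieldTheory.Balaban1983to89.T3UnitLawDensityEML (ℰp)
open Summit.QuantumFields.YangMills.Theorems.RandomisedStokesOffSliverArith

namespace Summit.QuantumFields.YangMills.Theorems.RandomisedStokesOffSliverArithX

/-! ## §1 The chaos term off the sliver -/

/-- **THE CHAOS TERM OFF THE SLIVER** (`0 < γ ≤ 1`, `b₀ ≥ 1`, `N ≤ p₀`, `N ≥ 2`, `(N−1)α_X > 1`, `D ≥ 1`, `c_X > 0`, `C_X ≥ 0`): there is
`A ≥ 0` such that for all `j ≤ K` with `(j+1)^N ≤ p(g_{K−j})` the plaquette count times the chaos term of the per-plaquette bound is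
`≤ A·2^{−(K−j)}` (`η/(γL^{−h}) = p/(2D(j+1)g) ≥ P^{N−1}/(2D)`). [cite: Balaban1985UV3, (7) p.257] -/
theorem offSliver_X_term (F : T3Family) {γ b₀ p₀ : ℝ} (hγ : 0 < γ) (hγ1 : γ ≤ 1) (hb₀ : 1 ≤ b₀) {N : ℕ} (hNp₀ : (N : ℝ) ≤ p₀)
    (hN2 : 2 ≤ N) {D αX cX CX : ℝ} {AX : ℕ} (hD : 1 ≤ D) (hαX : 0 < αX) (hcX : 0 < cX) (hCX : 0 ≤ CX)
    (heX : 1 < ((N - 1 : ℕ) : ℝ) * αX) :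
    ∃ A : ℝ, 0 ≤ A ∧ ∀ K j : ℕ, j ≤ K → ((j : ℝ) + 1) ^ N ≤ B10.pFun b₀ p₀ (Real.sqrt (γ * ((F.L : ℝ)⁻¹) ^ (K - j))) →
      (9 * (8 * (F.L : ℝ) ^ (3 * F.m) * ((F.L : ℝ) ^ (K - j)) ^ 3)) *
        (CX * (F.scheme ℰp γ).β K ^ AX *
          Real.exp (-((cX * ((θBal F.L γ b₀ p₀ (K - j) / (2 * D * ((j : ℝ) + 1))) /
            (γ * ((F.L : ℝ)⁻¹) ^ (K - j)))) ^ αX))) ≤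
      A * ((1 : ℝ) / 2) ^ (K - j) := by
  have hLn : 2 ≤ F.L := F.hL.2
  have hL2 : (2 : ℝ) ≤ F.L := by exact_mod_cast hLn
  have hL1 : (1 : ℝ) < F.L := by linarith
  have hL0 : (0 : ℝ) < F.L := by linarith
  have hpowexp : ∀ n : ℕ, (F.L : ℝ) ^ n = Real.exp ((n : ℝ) * Real.log F.L) := fun n => by
    rw [Real.exp_nat_mul, Real.exp_log hL0]
  set ℓ : ℝ := Real.log F.L with hℓ
  have hℓ0 : 0 < ℓ := Real.log_pos hL1
  have hℓ2 : Real.log 2 ≤ ℓ := Real.log_le_log two_pos hL2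
  have hD0 : 0 < D := by linarith
  set κ : ℝ := (cX / (2 * D)) ^ αX with hκ
  have hκ0 : 0 < κ := Real.rpow_pos_of_pos (div_pos hcX (by positivity)) αX
  set e : ℝ := ((N - 1 : ℕ) : ℝ) * αX with he
  set k : ℝ := 8 + (AX : ℝ) * (4 + ℓ) with hk
  have hk0 : 0 ≤ k := by positivity
  set M : ℝ := k * max 1 ((k / κ) ^ (1 / (e - 1))) with hM
  set Kc : ℝ := Real.log (72 * (F.L : ℝ) ^ (3 * F.m)) + Real.log (CX + 1) with hKc
  refine ⟨Real.exp (Kc + M), (Real.exp_pos _).le, fun K j hjK hoff => ?_⟩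
  obtain ⟨P, hP1, hJP, hPN, hhℓ, hlγ, hg0, hg1, hp1, hθ, hβ, -⟩ := offSliver_facts F hγ hγ1 hb₀ hNp₀ K j hjK hoff
  set h : ℕ := K - j with hh
  set x : ℝ := γ * ((F.L : ℝ)⁻¹) ^ h with hx
  set g : ℝ := Real.sqrt x with hg
  set p : ℝ := B10.pFun b₀ p₀ g with hp
  set θ : ℝ := θBal F.L γ b₀ p₀ h with hθ_def
  set β : ℝ := (F.scheme ℰp γ).β K with hβ_def
  set J : ℝ := (j : ℝ) + 1 with hJ
  set Lj : ℝ := (F.L : ℝ) ^ j with hLj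
  have hP0 : 0 < P := one_pos.trans_le hP1
  have hJ1 : 1 ≤ J := by rw [hJ]; have : (0:ℝ) ≤ j := Nat.cast_nonneg j; linarith
  have hJ0 : 0 < J := by linarith
  have hjP : (j : ℝ) ≤ P := by linarith
  have hLj0 : 0 < Lj := pow_pos hL0 j
  have hLh : (F.L : ℝ) ^ h = Real.exp ((h : ℝ) * ℓ) := hpowexp h
  have hLjexp : Lj = Real.exp ((j : ℝ) * ℓ) := hpowexp j
  have hγinv : γ⁻¹ = Real.exp (-Real.log γ) := by rw [Real.exp_neg, Real.exp_log hγ]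
  have hp0 : 0 < p := one_pos.trans_le hp1
  have hx0 : 0 < x := by have := Real.sqrt_pos.mp hg0; exact this
  have hxg : x = g ^ 2 := (Real.sq_sqrt hx0.le).symm
  have hβ1 : β = γ⁻¹ * (F.L : ℝ) ^ h * Lj := hβ
  have hβpos : 0 < β := by rw [hβ1]; positivity
  -- exponential bounds
  have eLh : (F.L : ℝ) ^ h ≤ Real.exp (2 * P) := by rw [hLh]; exact Real.exp_le_exp.mpr hhℓ
  have hjℓ : (j : ℝ) * ℓ ≤ ℓ * P := by rw [mul_comm]; exact mul_le_mul_of_nonneg_left hjP hℓ0.le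
  have eLj : Lj ≤ Real.exp (ℓ * P) := by rw [hLjexp]; exact Real.exp_le_exp.mpr hjℓ
  have eγ : γ⁻¹ ≤ Real.exp (2 * P) := by rw [hγinv]; exact Real.exp_le_exp.mpr hlγ
  have eβ : β ≤ Real.exp ((4 + ℓ) * P) := by
    rw [hβ1, show (4 + ℓ) * P = (2 * P + 2 * P) + ℓ * P by ring]
    exact mul_le_exp_add (mul_le_exp_add eγ (by positivity) eLh) hLj0.le eLj
  -- (b1) the plaquette count
  have b1 : 9 * (8 * (F.L : ℝ) ^ (3 * F.m) * ((F.L : ℝ) ^ h) ^ 3) ≤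
      Real.exp (Real.log (72 * (F.L : ℝ) ^ (3 * F.m)) + 6 * P) := by
    have h3 : ((F.L : ℝ) ^ h) ^ 3 ≤ Real.exp (6 * P) := by
      calc ((F.L : ℝ) ^ h) ^ 3 ≤ (Real.exp (2 * P)) ^ 3 := pow_le_pow_left₀ (by positivity) eLh 3
        _ = Real.exp (6 * P) := by rw [← Real.exp_nat_mul]; ring_nf
    rw [Real.exp_add, Real.exp_log (by positivity)]
    calc 9 * (8 * (F.L : ℝ) ^ (3 * F.m) * ((F.L : ℝ) ^ h) ^ 3) = (72 * (F.L : ℝ) ^ (3 * F.m)) * ((F.L : ℝ) ^ h) ^ 3 := by ring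
      _ ≤ (72 * (F.L : ℝ) ^ (3 * F.m)) * Real.exp (6 * P) := mul_le_mul_of_nonneg_left h3 (by positivity)
  -- (b3) the printed prefactor
  have b3 : CX * β ^ AX ≤ Real.exp (Real.log (CX + 1) + (AX : ℝ) * (4 + ℓ) * P) := by
    have hC : CX ≤ Real.exp (Real.log (CX + 1)) := by rw [Real.exp_log (by linarith)]; linarith
    have hβA : β ^ AX ≤ Real.exp ((AX : ℝ) * ((4 + ℓ) * P)) := by
      calc β ^ AX ≤ (Real.exp ((4 + ℓ) * P)) ^ AX := pow_le_pow_left₀ hβpos.le eβ AX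
        _ = Real.exp ((AX : ℝ) * ((4 + ℓ) * P)) := by rw [← Real.exp_nat_mul]
    have := mul_le_exp_add hC (pow_nonneg hβpos.le AX) hβA
    refine this.trans (Real.exp_le_exp.mpr (le_of_eq ?_)); ring
  -- (b4) the gain: `η/x = p/(2DJg) ≥ P^{N-1}/(2D)`
  have hratio : P ^ (N - 1) / (2 * D) ≤ (θ / (2 * D * J)) / x := by
    have h1 : (θ / (2 * D * J)) / x = p / (2 * D * J * g) := by
      rw [hθ, hxg]; field_simp
    rw [h1, div_le_div_iff₀ (by positivity) (by positivity)]
    -- `P^{N-1} (2 D J g) ≤ p (2 D)`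
    have hPN1 : P ^ (N - 1) * P = P ^ N := by rw [← pow_succ]; congr 1; omega
    have hJg : J * g ≤ P := by
      calc J * g ≤ J * 1 := mul_le_mul_of_nonneg_left hg1 hJ0.le
        _ = J := mul_one J
        _ ≤ P := hJP
    calc P ^ (N - 1) * (2 * D * J * g) = (2 * D) * (P ^ (N - 1) * (J * g)) := by ring
      _ ≤ (2 * D) * (P ^ (N - 1) * P) := by
          exact mul_le_mul_of_nonneg_left (mul_le_mul_of_nonneg_left hJg (pow_nonneg hP0.le _)) (by positivity)
      _ = (2 * D) * P ^ N := by rw [hPN1]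
      _ ≤ (2 * D) * p := mul_le_mul_of_nonneg_left hPN (by positivity)
      _ = p * (2 * D) := mul_comm _ _
  have b4 : Real.exp (-((cX * ((θ / (2 * D * J)) / x)) ^ αX)) ≤ Real.exp (-(κ * P ^ e)) := by
    refine Real.exp_le_exp.mpr (neg_le_neg ?_)
    have h0 : 0 ≤ cX * (P ^ (N - 1) / (2 * D)) := by positivity
    have h1 : cX * (P ^ (N - 1) / (2 * D)) ≤ cX * ((θ / (2 * D * J)) / x) := mul_le_mul_of_nonneg_left hratio hcX.le
    have h2 : (cX * (P ^ (N - 1) / (2 * D))) ^ αX = κ * P ^ e := by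
      rw [show cX * (P ^ (N - 1) / (2 * D)) = (cX / (2 * D)) * P ^ (N - 1) by ring,
        Real.mul_rpow (div_pos hcX (by positivity)).le (pow_nonneg hP0.le _), hκ, he, ← Real.rpow_natCast P (N - 1),
        ← Real.rpow_mul hP0.le]
    calc κ * P ^ e = (cX * (P ^ (N - 1) / (2 * D))) ^ αX := h2.symm
      _ ≤ _ := Real.rpow_le_rpow h0 h1 hαX.le
  -- (b5) the geometric factor
  have b5 : Real.exp (-(2 * P)) ≤ ((1 : ℝ) / 2) ^ h := by
    rw [one_div, inv_pow, ← Real.exp_log (pow_pos two_pos h), ← Real.exp_neg, Real.log_pow]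
    refine Real.exp_le_exp.mpr (neg_le_neg ?_)
    calc (h : ℝ) * Real.log 2 ≤ (h : ℝ) * ℓ := mul_le_mul_of_nonneg_left hℓ2 (Nat.cast_nonneg h)
      _ ≤ 2 * P := hhℓ
  -- (b6) the bounded exponent
  have b6 : k * P - κ * P ^ e ≤ M := linear_sub_rpow_le hk0 hκ0 heX hP1
  -- assemble
  have hT : (9 * (8 * (F.L : ℝ) ^ (3 * F.m) * ((F.L : ℝ) ^ h) ^ 3)) *
      (CX * β ^ AX * Real.exp (-((cX * ((θ / (2 * D * J)) / x)) ^ αX))) ≤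
      Real.exp ((Real.log (72 * (F.L : ℝ) ^ (3 * F.m)) + 6 * P) +
        ((Real.log (CX + 1) + (AX : ℝ) * (4 + ℓ) * P) + -(κ * P ^ e))) :=
    mul_le_exp_add b1 (by positivity) (mul_le_exp_add b3 (by positivity) b4)
  refine hT.trans ?_
  have hsum : (Real.log (72 * (F.L : ℝ) ^ (3 * F.m)) + 6 * P) +
        ((Real.log (CX + 1) + (AX : ℝ) * (4 + ℓ) * P) + -(κ * P ^ e)) = Kc + (k * P - κ * P ^ e) + -(2 * P) := by
    rw [hKc, hk]; ring
  rw [hsum, Real.exp_add, Real.exp_add]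
  calc Real.exp Kc * Real.exp (k * P - κ * P ^ e) * Real.exp (-(2 * P))
      ≤ Real.exp Kc * Real.exp M * ((1 : ℝ) / 2) ^ h := by gcongr
    _ = Real.exp (Kc + M) * ((1 : ℝ) / 2) ^ h := by rw [← Real.exp_add]

end Summit.QuantumFields.YangMills.Theorems.RandomisedStokesOffSliverArithX

end
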